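import Summits.QuantumFields.YangMills.Theorems.BalabanUVNodesN21ChartExponentConvexitySUN
import Summits.QuantumFields.YangMills.Theorems.BalabanUVNodesN21ChartExponentConvexityU1

/-!
# N21 (NE7c) · THE `U(1)` MODEL INSTANCE OF THE ANALYTIC ROAD: the complexified abelian (1.2) remainder is ENTIRE with an
# explicit sup letter, dag-n21-w3 g3's ★★′ `convexOn_expansion_of_analyticSupBound` FED BY NAME, and the rate comparison
# with the real-variable second-order row

Width seat pub-ymgap-dag-n21-w5 (g2; director-ym R399 (3a) ∕ №209 second wave, dag-lead WIDTH-209), node N21 = NE7c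
(single-run shell-weight bound, NOT PRINTED in [Bałaban 1983–89], NOT proved), lane K3⁷ `SpineGivenEndpointR13SepCoPH`
(stmt-QuantumFields-20544, `--kind proof --supports … --as helper`).  Located hand «P2-U1A» of WIDTH-209 N21 piece 2
(pen dag-n21-w3 g3, bus I.29953; this seat's CLAIM-1 I.30026): FILE 3 of this seat's `U(1)` model-instance lineage
(p606810 `…N21Sect1RemainderSecondOrderU1` = the REAL-VARIABLE second-order row `Mq = gΦc_φ` by hand; p607837
`…N21ChartExponentConvexityU1` = dag-n21-w3's ★ fed with it).

THE POINT.  dag-n21-w3 g3's analytic road (p607734 ★★′ `N21ChartExponentConvexitySUN.convexOn_expansion_of_analyticSupBound`)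
reads the convexity of the [LF-II] (1.2) exponent `c + ½·Qf + lin + Vt` from (1.9) + structure + ONE NODE-O-shaped VALUE row
for the remainder on a COMPLEX neighbourhood — `Vt = Re Φ∘ι`, `Φ` complex differentiable with `‖Φ‖ ≤ S` on the `r`-balls
about the real window points, `diam K < r`, clause `16·d·(100M)^{d+1}·S ≤ γ₀·r²` — the second-order row being SUPPLIED by
Cauchy (`Mq = 2S∕r²`), not computed.  This file INSTANTIATES that road at a genuine lattice action, the abelian model of
`B16Txt357ThirdOrderU1` (`g⁻²V = g⁻²·Σ_p ζ₀(p)·rem₃(θ_p, gφ_p)`, `φ = ∂H_{1,k}B′` linear — here a real chart MATRIX `H`):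
* §1 (one plaquette) the complexified third-order remainder `rem₃ℂ(θ, h) = cos θ·(1 − h²∕2 − cos h) + sin θ·(sin h − h)`
  (`rem3_eq`'s form with `Complex.cos ∕ Complex.sin`; real slice = `rem₃`) is ENTIRE, equals
  `−½[e^{iθ}(e^{ih} − P₂(ih)) + e^{−iθ}(e^{−ih} − P₂(−ih))]` (`P₂` the quadratic Taylor polynomial of `exp`), whence the
  sup letter ★ `‖rem₃ℂ(θ, h)‖ ≤ ‖h‖³·e^{‖h‖}` for EVERY complex `h` (Mathlib's `Complex.norm_exp_sub_sum_le_norm_mul_exp`);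
* §2 (the block) the complexified `g⁻²Vℂ(w) = g⁻²·Σ_p ζ_p·rem₃ℂ(θ_p, g·((H.map ofReal) *ᵥ w)_p)` is ENTIRE with real slice
  `g⁻²·V12 g ζ θ (H *ᵥ x)`, and on the complex sup-norm `r`-ball about a real window point (`|(H *ᵥ x)_p| ≤ Φ`, row-sum
  letter `Σ_b |H_{pb}| ≤ c_H`, `Σ_p ζ_p ≤ Z`) obeys ★★ the SUP LETTER `‖g⁻²Vℂ(w)‖ ≤ S(g, Φ, r) = g·(Φ + c_H r)³·e^{g(Φ + c_H r)}·Z`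
  — rate `g¹`, no window cap (entire), the complex-neighbourhood form of print's VALUE row *"O(g_k^{1−β})|Λ|"* for this model;
* §3 ★★★ `convexOn_chartExponentU1_analytic`: ★★′ APPLIED — the abelian (1.2) exponent
  `c + ½·v ⬝ᵥ (A *ᵥ v) + ℓ v + g⁻²·V12 g ζ θ (H *ᵥ v)` is CONVEX on any convex window of diameter `< r` under (1.9) `∀ v`
  and the analytic clause `16·d·(100M)^{d+1}·S(g, Φ, r) ≤ γ₀·r²`;
* FILE 3b (`…N21ChartExponentAnalyticU1Rates`, next): the RATE COMPARISON with the real-variable road (Cauchy's letter at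
  the window radius `r = Φ∕c_H` is `16·e^{2gΦ}` times the real row `g·Φ·Z·c_H²` — same rate `g¹·Φ`), the clause at print's
  bookkeeping `Φ ≤ K·p₀(g_k)` («for g_k sufficiently small»), and the A6 ∕ A2 witness (every binder of ★★★ jointly
  inhabited by the one-plaquette lattice cosine action).

HONEST FRAMING.  [textbook] complex Taylor bounds ∕ finite sums + composition BY NAME (p607734 ★★′; `B16Txt357ThirdOrderU1`)
over the tree's `U(1)` MODEL INSTANCE (abelian: no `D₃`∕BCH terms of [Balaban1987RG1] (2.6)–(2.7); for non-abelian `G`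
those are part of `V` and are NOT reproduced); the identification of `(ζ₀, θ, H = ∂H_{1,k}, Φ ≤ K·p₀(g_k), r, Z ≤ #Λ*)`
with [LF-II] (1.2)'s members and print's analyticity domain is LOCATED typing, NOT asserted; print states the VALUE row on
the real chart only; nothing of Bałaban's asserted; (M1) ∕ NE7c NOT PRINTED ∕ NOT proved; N21 NOT discharged; K3⁷ NOT
claimed; counts unmoved (typed 28∕28 · discharged 5∕27); count-neutral; one finite 𝕋⁴ at fixed ε — R4 would close only
the conditional finite-𝕋⁴ rung `BalabanLadder.UV`, NOT the Yang–Mills mass gap (Clay); nothing about ℝ⁴ ∕ OS.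
THEOREMS ONLY: 0 `def`, 0 `sorry`.
-/

set_option autoImplicit false

open Real Finset Set Matrix Metric Complex

namespace Summit.QuantumFields.YangMills.Theorems.N21ChartExponentAnalyticU1

open Literature.MathematicalPhysics.QuantumFieldTheory.Balaban1983to89.B16Txt357ThirdOrderU1
  (rem3 rem3_eq V12 V12_eq_sum_rem3)
open Literature.MathematicalPhysics.QuantumFieldTheory.Balaban1983to89.B16Sect1Wilson (Ineq19)

/-! ## §1  One plaquette: the complexified third-order remainder `rem₃ℂ(θ, h)` is entire, with an explicit sup letter -/

section OnePlaquette

/-- **REAL SLICE**: at a real increment the complexified one-plaquette remainder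
`cos θ·(1 − h²∕2 − cos h) + sin θ·(sin h − h)` is `rem₃(θ, h)` of `B16Txt357ThirdOrderU1` (its `rem3_eq` form). [textbook] -/
theorem rem3_complex_ofReal (θ t : ℝ) :
    (Real.cos θ : ℂ) * (1 - (t : ℂ) ^ 2 / 2 - Complex.cos t) + (Real.sin θ : ℂ) * (Complex.sin t - t) =
      ((rem3 θ t : ℝ) : ℂ) := by
  rw [rem3_eq]
  push_cast
  ring

/-- **ENTIRE**: the complexified one-plaquette remainder is complex differentiable everywhere in the increment. [textbook] -/
theorem differentiable_rem3_complex (θ : ℝ) :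
    Differentiable ℂ fun h : ℂ =>
      (Real.cos θ : ℂ) * (1 - h ^ 2 / 2 - Complex.cos h) + (Real.sin θ : ℂ) * (Complex.sin h - h) := by
  fun_prop

/-- **EXPONENTIAL FORM**: `rem₃ℂ(θ, h) = −½[e^{iθ}(e^{ih} − P₂(ih)) + e^{−iθ}(e^{−ih} − P₂(−ih))]` with
`P₂(z) = Σ_{m<3} z^m∕m!` — the third-order Taylor remainders of the two exponentials in `cos(θ + h) = ½(e^{i(θ+h)} + e^{−i(θ+h)})`.
[textbook] -/
theorem rem3_complex_eq_exp (θ : ℝ) (h : ℂ) :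
    (Real.cos θ : ℂ) * (1 - h ^ 2 / 2 - Complex.cos h) + (Real.sin θ : ℂ) * (Complex.sin h - h) =
      -(1 / 2) * (exp (θ * I) * (exp (h * I) - ∑ m ∈ range 3, (h * I) ^ m / m.factorial)
        + exp (-θ * I) * (exp (-h * I) - ∑ m ∈ range 3, (-h * I) ^ m / m.factorial)) := by
  have hP : ∀ z : ℂ, ∑ m ∈ range 3, z ^ m / (m.factorial : ℂ) = 1 + z + z ^ 2 / 2 := by
    intro z
    simp only [Finset.sum_range_succ, Finset.sum_range_zero, Nat.factorial, pow_zero, pow_one, Nat.cast_one,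
      zero_add, div_one]
    norm_num
  rw [hP, hP, Complex.ofReal_cos, Complex.ofReal_sin, Complex.cos, Complex.sin, Complex.cos, Complex.sin]
  have hI : I ^ 2 = -1 := Complex.I_sq
  linear_combination ((exp (-↑θ * I) - exp (↑θ * I)) * (exp (-h * I) - exp (h * I)) / 4
    - (exp (↑θ * I) + exp (-↑θ * I)) * h ^ 2 / 4) * hI

/-- ★ **THE ONE-PLAQUETTE SUP LETTER**: `‖rem₃ℂ(θ, h)‖ ≤ ‖h‖³·e^{‖h‖}` for EVERY complex increment `h` and real background
angle `θ` (`‖e^{±iθ}‖ = 1` and Mathlib's `‖e^z − Σ_{m<3} z^m∕m!‖ ≤ ‖z‖³e^{‖z‖}` at `z = ±ih`).  Compare the real row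
`|rem₃(θ, h)| ≤ |h|³∕4` (`abs_rem3_le`, `|h| ≤ 1`): third order in both, the complex constant `e^{‖h‖} ≤ e` on the unit ball.
[textbook] -/
theorem norm_rem3_complex_le (θ : ℝ) (h : ℂ) :
    ‖(Real.cos θ : ℂ) * (1 - h ^ 2 / 2 - Complex.cos h) + (Real.sin θ : ℂ) * (Complex.sin h - h)‖ ≤
      ‖h‖ ^ 3 * Real.exp ‖h‖ := by
  rw [rem3_complex_eq_exp]
  have h1 : ‖exp (↑θ * I)‖ = 1 := Complex.norm_exp_ofReal_mul_I θ
  have h2 : ‖exp (-↑θ * I)‖ = 1 := by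
    rw [← Complex.ofReal_neg]; exact Complex.norm_exp_ofReal_mul_I (-θ)
  have hhI : ‖h * I‖ = ‖h‖ := by rw [norm_mul, Complex.norm_I, mul_one]
  have hhI' : ‖-h * I‖ = ‖h‖ := by rw [norm_mul, norm_neg, Complex.norm_I, mul_one]
  have hA := Complex.norm_exp_sub_sum_le_norm_mul_exp (h * I) 3
  have hB := Complex.norm_exp_sub_sum_le_norm_mul_exp (-h * I) 3
  rw [hhI] at hA
  rw [hhI'] at hB
  calc ‖-(1 / 2) * (exp (↑θ * I) * (exp (h * I) - ∑ m ∈ range 3, (h * I) ^ m / m.factorial)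
          + exp (-↑θ * I) * (exp (-h * I) - ∑ m ∈ range 3, (-h * I) ^ m / m.factorial))‖
      = 1 / 2 * ‖exp (↑θ * I) * (exp (h * I) - ∑ m ∈ range 3, (h * I) ^ m / m.factorial)
          + exp (-↑θ * I) * (exp (-h * I) - ∑ m ∈ range 3, (-h * I) ^ m / m.factorial)‖ := by
        rw [norm_mul]; norm_num
    _ ≤ 1 / 2 * (‖exp (↑θ * I) * (exp (h * I) - ∑ m ∈ range 3, (h * I) ^ m / m.factorial)‖
          + ‖exp (-↑θ * I) * (exp (-h * I) - ∑ m ∈ range 3, (-h * I) ^ m / m.factorial)‖) :=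
        mul_le_mul_of_nonneg_left (norm_add_le _ _) (by norm_num)
    _ ≤ 1 / 2 * (‖h‖ ^ 3 * Real.exp ‖h‖ + ‖h‖ ^ 3 * Real.exp ‖h‖) := by
        rw [norm_mul, norm_mul, h1, h2, one_mul, one_mul]
        exact mul_le_mul_of_nonneg_left (add_le_add hA hB) (by norm_num)
    _ = ‖h‖ ^ 3 * Real.exp ‖h‖ := by ring

end OnePlaquette


/-! ## §2  The block: the complexified abelian (1.2) remainder along a real chart matrix, and its sup letter -/

section Block

variable {κ : Type*} [Fintype κ] {ι : Type*} [Fintype ι]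

omit [Fintype ι] in
/-- the complexified chart at a real point is the real chart: `((H.map ofReal) *ᵥ ↑x)_p = ↑((H *ᵥ x)_p)`. [folklore] -/
theorem mulVec_complex_ofReal (H : Matrix ι κ ℝ) (x : κ → ℝ) (p : ι) :
    (H.map ((↑) : ℝ → ℂ) *ᵥ fun b => (x b : ℂ)) p = (((H *ᵥ x) p : ℝ) : ℂ) := by
  simp only [Matrix.mulVec, dotProduct, Matrix.map_apply]
  push_cast
  rfl

omit [Fintype ι] in
/-- the complexified chart is additive in the field: `(Hℂ *ᵥ w)_p = ↑((H *ᵥ x)_p) + (Hℂ *ᵥ (w − ↑x))_p`. [folklore] -/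
theorem mulVec_complex_split (H : Matrix ι κ ℝ) (x : κ → ℝ) (w : κ → ℂ) (p : ι) :
    (H.map ((↑) : ℝ → ℂ) *ᵥ w) p =
      (((H *ᵥ x) p : ℝ) : ℂ) + (H.map ((↑) : ℝ → ℂ) *ᵥ (w - fun b => (x b : ℂ))) p := by
  rw [Matrix.mulVec_sub, Pi.sub_apply, mulVec_complex_ofReal]
  ring

omit [Fintype ι] in
/-- **COORDINATES ON THE COMPLEX BALL.**  With the row-sum letter `Σ_b |H_{pb}| ≤ c_H` of the chart matrix, a real window
point `x` with `|(H *ᵥ x)_p| ≤ Φ`, and a complex point `w` with `‖w − ↑x‖ ≤ r` (sup norm), every complexified plaquette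
increment obeys `‖(Hℂ *ᵥ w)_p‖ ≤ Φ + c_H·r`. [folklore] -/
theorem norm_mulVec_complex_le (H : Matrix ι κ ℝ) {cH Φ r : ℝ} (hH : ∀ p, ∑ b, |H p b| ≤ cH)
    {x : κ → ℝ} (hx : ∀ p, |(H *ᵥ x) p| ≤ Φ) {w : κ → ℂ} (hw : ‖w - fun b => (x b : ℂ)‖ ≤ r) (p : ι) :
    ‖(H.map ((↑) : ℝ → ℂ) *ᵥ w) p‖ ≤ Φ + cH * r := by
  rw [mulVec_complex_split H x w p]
  refine (norm_add_le _ _).trans (add_le_add ?_ ?_)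
  · rw [Complex.norm_real, Real.norm_eq_abs]; exact hx p
  · have hr : 0 ≤ r := (norm_nonneg _).trans hw
    simp only [Matrix.mulVec, dotProduct, Matrix.map_apply]
    calc ‖∑ b, (H p b : ℂ) * (w - fun b => (x b : ℂ)) b‖
        ≤ ∑ b, ‖(H p b : ℂ) * (w - fun b => (x b : ℂ)) b‖ := norm_sum_le _ _
      _ ≤ ∑ b, |H p b| * r := by
          refine Finset.sum_le_sum fun b _ => ?_
          rw [norm_mul, Complex.norm_real, Real.norm_eq_abs]
          exact mul_le_mul_of_nonneg_left ((norm_le_pi_norm _ b).trans hw) (abs_nonneg _)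
      _ = (∑ b, |H p b|) * r := (Finset.sum_mul _ _ _).symm
      _ ≤ cH * r := mul_le_mul_of_nonneg_right (hH p) hr

/-- **REAL SLICE OF THE COMPLEXIFIED BLOCK REMAINDER**: at a real field the complexified `g⁻²V` is the abelian (1.2)
remainder `g⁻²·V12 g ζ θ (H *ᵥ x)` of `B16Txt357ThirdOrderU1`. [textbook] -/
theorem V12_complex_ofReal (g : ℝ) (ζ θ : ι → ℝ) (H : Matrix ι κ ℝ) (VC : (κ → ℂ) → ℂ)
    (hVC : ∀ w, VC w = (1 / g ^ 2 : ℂ) * ∑ p, (ζ p : ℂ) *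
      ((Real.cos (θ p) : ℂ) * (1 - ((g : ℂ) * (H.map ((↑) : ℝ → ℂ) *ᵥ w) p) ^ 2 / 2
          - Complex.cos ((g : ℂ) * (H.map ((↑) : ℝ → ℂ) *ᵥ w) p))
        + (Real.sin (θ p) : ℂ) * (Complex.sin ((g : ℂ) * (H.map ((↑) : ℝ → ℂ) *ᵥ w) p)
          - (g : ℂ) * (H.map ((↑) : ℝ → ℂ) *ᵥ w) p)))
    (x : κ → ℝ) :
    VC (fun b => (x b : ℂ)) = ((1 / g ^ 2 * V12 g ζ θ (H *ᵥ x) : ℝ) : ℂ) := by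
  rw [hVC, V12_eq_sum_rem3]
  simp only [mulVec_complex_ofReal]
  push_cast
  congr 1
  refine Finset.sum_congr rfl fun p _ => ?_
  rw [← rem3_complex_ofReal]
  push_cast
  ring

/-- **THE COMPLEXIFIED BLOCK REMAINDER IS ENTIRE** (a finite sum of entire one-plaquette remainders composed with the
ℂ-linear complexified chart). [textbook] -/
theorem differentiable_V12_complex (g : ℝ) (ζ θ : ι → ℝ) (H : Matrix ι κ ℝ) (VC : (κ → ℂ) → ℂ)
    (hVC : ∀ w, VC w = (1 / g ^ 2 : ℂ) * ∑ p, (ζ p : ℂ) *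
      ((Real.cos (θ p) : ℂ) * (1 - ((g : ℂ) * (H.map ((↑) : ℝ → ℂ) *ᵥ w) p) ^ 2 / 2
          - Complex.cos ((g : ℂ) * (H.map ((↑) : ℝ → ℂ) *ᵥ w) p))
        + (Real.sin (θ p) : ℂ) * (Complex.sin ((g : ℂ) * (H.map ((↑) : ℝ → ℂ) *ᵥ w) p)
          - (g : ℂ) * (H.map ((↑) : ℝ → ℂ) *ᵥ w) p))) :
    Differentiable ℂ VC := by
  rw [funext hVC]
  simp only [Matrix.mulVec, dotProduct, Matrix.map_apply]
  fun_prop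

/-- ★★ **THE SUP LETTER OF THE COMPLEXIFIED ABELIAN (1.2) REMAINDER ON THE COMPLEX `r`-BALL ABOUT A REAL WINDOW POINT.**
For the chart matrix `H` with row-sum letter `Σ_b |H_{pb}| ≤ c_H` (`c_H ≥ 0`), a weight `ζ ≥ 0` with `Σ_p ζ_p ≤ Z`, a real
point `x` of the window `|(H *ᵥ x)_p| ≤ Φ` (`Φ ≥ 0`), `g > 0`, and any complex `w` with `‖w − ↑x‖ ≤ r`:
`‖g⁻²·Vℂ(w)‖ ≤ S(g, Φ, r) := g·(Φ + c_H r)³·e^{g(Φ + c_H r)}·Z` — §1's `‖rem₃ℂ(θ,u)‖ ≤ ‖u‖³e^{‖u‖}` at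
`‖u_p‖ ≤ g(Φ + c_H r)`; two powers of `g` cancel the `g⁻²`, ONE is left (rate `g¹`, as for the real rows); no window
cap `gΦ ≤ ½` is needed (the remainder is entire).  Print's VALUE row for `V` is *"O(g_k^{1−β})|Λ|"* on the real chart
([LF-II] p. 357); this is its complex-neighbourhood form for the abelian model, with the `O(·)` explicit. [textbook] -/
theorem norm_V12_complex_le {g cH Φ r Z : ℝ} (hg : 0 < g) (hΦ : 0 ≤ Φ) (hcH : 0 ≤ cH) {ζ : ι → ℝ}
    (hζ : ∀ p, 0 ≤ ζ p) (hZ : ∑ p, ζ p ≤ Z) (θ : ι → ℝ) (H : Matrix ι κ ℝ) (hH : ∀ p, ∑ b, |H p b| ≤ cH)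
    (VC : (κ → ℂ) → ℂ)
    (hVC : ∀ w, VC w = (1 / g ^ 2 : ℂ) * ∑ p, (ζ p : ℂ) *
      ((Real.cos (θ p) : ℂ) * (1 - ((g : ℂ) * (H.map ((↑) : ℝ → ℂ) *ᵥ w) p) ^ 2 / 2
          - Complex.cos ((g : ℂ) * (H.map ((↑) : ℝ → ℂ) *ᵥ w) p))
        + (Real.sin (θ p) : ℂ) * (Complex.sin ((g : ℂ) * (H.map ((↑) : ℝ → ℂ) *ᵥ w) p)
          - (g : ℂ) * (H.map ((↑) : ℝ → ℂ) *ᵥ w) p)))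
    {x : κ → ℝ} (hx : ∀ p, |(H *ᵥ x) p| ≤ Φ) {w : κ → ℂ} (hw : ‖w - fun b => (x b : ℂ)‖ ≤ r) :
    ‖VC w‖ ≤ g * (Φ + cH * r) ^ 3 * Real.exp (g * (Φ + cH * r)) * Z := by
  rw [hVC, norm_mul]
  have hg2 : ‖(1 / g ^ 2 : ℂ)‖ = 1 / g ^ 2 := by
    rw [show (1 / g ^ 2 : ℂ) = ((1 / g ^ 2 : ℝ) : ℂ) by push_cast; ring, Complex.norm_real, Real.norm_eq_abs,
      abs_of_pos (by positivity)]
  rw [hg2]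
  -- the common bound on the complexified increments
  set T : ℝ := g * (Φ + cH * r) with hT
  have hr : 0 ≤ r := (norm_nonneg _).trans hw
  have hT0 : 0 ≤ T := by rw [hT]; positivity
  have hu : ∀ p, ‖(g : ℂ) * (H.map ((↑) : ℝ → ℂ) *ᵥ w) p‖ ≤ T := fun p => by
    rw [norm_mul, Complex.norm_real, Real.norm_eq_abs, abs_of_pos hg, hT]
    exact mul_le_mul_of_nonneg_left (norm_mulVec_complex_le H hH hx hw p) hg.le
  -- per plaquette: `‖ζ_p · rem₃ℂ‖ ≤ ζ_p · T³ e^T`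
  have hmono : ∀ {s : ℝ}, 0 ≤ s → s ≤ T → s ^ 3 * Real.exp s ≤ T ^ 3 * Real.exp T := fun hs hsT =>
    mul_le_mul (pow_le_pow_left₀ hs hsT 3) (Real.exp_le_exp.2 hsT) (Real.exp_nonneg _) (by positivity)
  have hper : ∀ p, ‖(ζ p : ℂ) *
      ((Real.cos (θ p) : ℂ) * (1 - ((g : ℂ) * (H.map ((↑) : ℝ → ℂ) *ᵥ w) p) ^ 2 / 2
          - Complex.cos ((g : ℂ) * (H.map ((↑) : ℝ → ℂ) *ᵥ w) p))
        + (Real.sin (θ p) : ℂ) * (Complex.sin ((g : ℂ) * (H.map ((↑) : ℝ → ℂ) *ᵥ w) p)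
          - (g : ℂ) * (H.map ((↑) : ℝ → ℂ) *ᵥ w) p))‖ ≤ ζ p * (T ^ 3 * Real.exp T) := by
    intro p
    rw [norm_mul, Complex.norm_real, Real.norm_eq_abs, abs_of_nonneg (hζ p)]
    refine mul_le_mul_of_nonneg_left ?_ (hζ p)
    exact (norm_rem3_complex_le (θ p) _).trans (hmono (norm_nonneg _) (hu p))
  calc 1 / g ^ 2 * ‖∑ p, (ζ p : ℂ) *
        ((Real.cos (θ p) : ℂ) * (1 - ((g : ℂ) * (H.map ((↑) : ℝ → ℂ) *ᵥ w) p) ^ 2 / 2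
            - Complex.cos ((g : ℂ) * (H.map ((↑) : ℝ → ℂ) *ᵥ w) p))
          + (Real.sin (θ p) : ℂ) * (Complex.sin ((g : ℂ) * (H.map ((↑) : ℝ → ℂ) *ᵥ w) p)
            - (g : ℂ) * (H.map ((↑) : ℝ → ℂ) *ᵥ w) p))‖
      ≤ 1 / g ^ 2 * ∑ p, ζ p * (T ^ 3 * Real.exp T) :=
        mul_le_mul_of_nonneg_left ((norm_sum_le _ _).trans (Finset.sum_le_sum fun p _ => hper p))
          (by positivity)
    _ = 1 / g ^ 2 * ((∑ p, ζ p) * (T ^ 3 * Real.exp T)) := by rw [Finset.sum_mul]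
    _ ≤ 1 / g ^ 2 * (Z * (T ^ 3 * Real.exp T)) :=
        mul_le_mul_of_nonneg_left (mul_le_mul_of_nonneg_right hZ (by positivity)) (by positivity)
    _ = g * (Φ + cH * r) ^ 3 * Real.exp (g * (Φ + cH * r)) * Z := by
        rw [hT]; field_simp

end Block

/-! ## §3  ★★★ Convexity of the abelian (1.2) exponent BY THE ANALYTIC ROAD (dag-n21-w3 g3's ★★′ fed by name) -/

section AnalyticRoad

variable {κ : Type*} [Fintype κ] {ι : Type*} [Fintype ι]

/-- ★★★ **CONVEXITY OF THE ABELIAN (1.2) EXPONENT BY THE ANALYTIC ROAD** (the `U(1)` MODEL INSTANCE of dag-n21-w3 g3's ★★′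
`N21ChartExponentConvexitySUN.convexOn_expansion_of_analyticSupBound`, flat frame).  On a convex window `K ⊆ (κ → ℝ)` with
`|(H *ᵥ v)_p| ≤ Φ` (`Φ ≥ 0`) and diameter `< r` in the sup norm, the exponent
`φ v = c + ½·v ⬝ᵥ (A *ᵥ v) + ℓ v + g⁻²·V12 g ζ θ (H *ᵥ v)` ((1.2) with the `½`; the abelian `V`-term of
`B16Txt357ThirdOrderU1` read through the chart MATRIX `H`, print's `φ = ∂H_{1,k}B′`) is CONVEX on `K` under (1.9) for every
`v` and the ONE analytic clause `16·d·(100M)^{d+1}·S(g, Φ, r) ≤ γ₀·r²`, `S = g·(Φ + c_H r)³·e^{g(Φ + c_H r)}·Z` (§2 ★★).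
The remainder fed to ★★′ is the complexified `g⁻²V` (entire, §2), its VALUE row on the complex `r`-balls is §2's sup
letter; ★★′ supplies the second-order row by Cauchy (`Mq = 2S∕r²`) — NO real-variable second-order computation (contrast
p606810 ∕ p607837, where `Mq = gΦc_φ` was computed by hand).  No window cap `gΦ ≤ ½` is needed on this road; the price is
the diameter letter and the factor recorded in §4. [textbook] -/
theorem convexOn_chartExponentU1_analytic {K : Set (κ → ℝ)} (hK : Convex ℝ K) (φ : (κ → ℝ) → ℝ) (c : ℝ)
    (A : Matrix κ κ ℝ) (ℓ : (κ → ℝ) →ₗ[ℝ] ℝ) (H : Matrix ι κ ℝ) {ζ : ι → ℝ} (θ : ι → ℝ)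
    {g Φ cH Z r γ₀ M : ℝ} {d : ℕ}
    (hg : 0 < g) (hΦ : 0 ≤ Φ) (hcH : 0 ≤ cH) (hζ : ∀ p, 0 ≤ ζ p) (hZ : ∑ p, ζ p ≤ Z)
    (hH : ∀ p, ∑ b, |H p b| ≤ cH) (hd : 1 ≤ d) (hM : 0 < M) (hγ₀ : 0 < γ₀)
    (hexp : ∀ v ∈ K, φ v = c + 1 / 2 * (v ⬝ᵥ (A *ᵥ v)) + ℓ v + 1 / g ^ 2 * V12 g ζ θ (H *ᵥ v))
    (h19 : ∀ v, Ineq19 (v ⬝ᵥ (A *ᵥ v)) (∑ b, v b ^ 2) γ₀ d M)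
    (hwin : ∀ v ∈ K, ∀ p, |(H *ᵥ v) p| ≤ Φ)
    (hdiam : ∀ x ∈ K, ∀ y ∈ K, ‖y - x‖ < r)
    (hclause : 16 * d * (100 * M) ^ (d + 1) * (g * (Φ + cH * r) ^ 3 * Real.exp (g * (Φ + cH * r)) * Z) ≤
      γ₀ * r ^ 2) :
    ConvexOn ℝ K φ := by
  refine N21ChartExponentConvexitySUN.convexOn_expansion_of_analyticSupBound hK φ (fun v => v ⬝ᵥ (A *ᵥ v))
    (fun v => ℓ v) (fun v => 1 / g ^ 2 * V12 g ζ θ (H *ᵥ v)) c hexp A (fun _ => rfl) hd hM hγ₀ h19 ℓ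
    (fun _ => rfl)
    (fun w => (1 / g ^ 2 : ℂ) * ∑ p, (ζ p : ℂ) *
      ((Real.cos (θ p) : ℂ) * (1 - ((g : ℂ) * (H.map ((↑) : ℝ → ℂ) *ᵥ w) p) ^ 2 / 2
          - Complex.cos ((g : ℂ) * (H.map ((↑) : ℝ → ℂ) *ᵥ w) p))
        + (Real.sin (θ p) : ℂ) * (Complex.sin ((g : ℂ) * (H.map ((↑) : ℝ → ℂ) *ᵥ w) p)
          - (g : ℂ) * (H.map ((↑) : ℝ → ℂ) *ᵥ w) p)))
    (r := r) (S := g * (Φ + cH * r) ^ 3 * Real.exp (g * (Φ + cH * r)) * Z) ?_ ?_ ?_ hdiam hclause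
  · -- the real slice: `g⁻²V(H x) = Re (g⁻²Vℂ)(↑x)`
    intro x _
    rw [V12_complex_ofReal g ζ θ H _ (fun _ => rfl) x, Complex.ofReal_re]
  · -- entire, hence differentiable on every ball
    intro x _
    exact (differentiable_V12_complex g ζ θ H _ (fun _ => rfl)).differentiableOn
  · -- the sup letter on the `r`-ball about a real window point
    intro x hx u hu
    exact norm_V12_complex_le hg hΦ hcH hζ hZ θ H hH _ (fun _ => rfl) (hwin x hx) (mem_ball_iff_norm.1 hu).le

end AnalyticRoad

end Summit.QuantumFields.YangMills.Theorems.N21ChartExponentAnalyticU1
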